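import Summits.Ventures.Crystal3D.Theorems.StickyWulffConstantPolycrystalWulffBoundTwinCapsCoaxialCaps
import Summits.Ventures.Crystal3D.Theorems.StickyWulffConstantPolycrystalWulffBoundPiecewiseChimera
import Summits.Ventures.Crystal3D.Theorems.StickyWulffConstantPolycrystalWulffBoundQuantile

/-!
# `PolycrystalWulffBound`, rung `rung_twinCaps` — step 1: the CHIMERA lower bound for a grain carrying
# finitely many separated TWIN CAPS about DIFFERENT axes (line `PolyDensity`, crux `stmt-Ventures-19482`)

Route `StickyWulffConstant` of the venture `Summits/Ventures/Crystal3D`, second prover lane (poly-p2,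
gen 12).  The texture: a parent grain `P` (frame `A₀`) lying below the planes `⟪x, m i⟫ = t i`
(`i < k`), and caps `C i ⊆ {t i < ⟪x, m i⟫}` carrying frames `B i` CO-AXIAL WITH `A₀` ABOUT `m i`
(the crux's clause `Ax (m i) A₀ (B i)`: each cap is the parent's lattice or its coherent twin across
the basal plane `⊥ m i`; the axes `m i` may all be different), the caps pairwise `δ`-separated.  Every
wall of this texture is a coherent basal twin plane — wall budget ZERO — so no slide / relabelling
rung can pay for anything; this file proves the volume half of a Brunn–Minkowski route that needs no
budget and NO COMMON FLAG:

  `|E'|^{1/3} + r·32^{1/3} ≤ |U|^{1/3}`,  `E' = P ∪ ⋃ C i`,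

for every measurable `U` containing the «chimera neighbourhood» `(P + r·W(A₀)) ∪ ⋃ (C i + r·W(B i))`
and every `0 < r ≤ δ / (2(√5+1))` (`twinCaps_chimera_lower`).
Proof (PIECEWISE Brunn–Minkowski with PROPORTIONAL QUANTILE TARGETS — a discrete Knothe map): with
`V = |E'|`, choose heights `s i` with `|W(A₀) ∩ {s i < ⟪y, m i⟫}| = 32·|C i|/V` (quantiles of the
compact body, `exists_quantile_of_isCompact`); swell the parent by `P' = W(A₀) ∩ {∀ i, ⟪y, m i⟫ ≤ s i}`
(volume `≥ 32·|P|/V`) and cap `i` by `K i = W(B i) ∩ {s i < ⟪y, m i⟫}` (volume `= 32·|C i|/V`: the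
cap volumes of `W(A₀)` and `W(B i)` along their common axis agree, `volume_cruxWulffBody_inter_eq_of_coaxial`,
by `exists_frame_cruxWulffBody` and the central symmetry of the body).  The swollen pieces live in the
pairwise disjoint regions `{∀ i, ⟪y, m i⟫ < t i + r s i}`, `{t i + r s i < ⟪y, m i⟫} ∩ (C i)_{r(√5+1)}`,
and the tree's Brunn–Minkowski inequality (`Literature.Analysis.Convexity.brunnMinkowski_pow`) gives
piece by piece `(|G|^{1/3} + r(32|G|/V)^{1/3})³`, whose sum is EXACTLY `(V^{1/3} + r·32^{1/3})³`.
The matching upper bound is the landed `volume_chimera_texture_le`; the rung is assembled in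
`…RungTwinCaps.lean`.
WHAT THIS IS NOT: the rung; nothing on perimeters; caps on caps (trees) and lamellar stacks on facets
are not treated here (same method); the crux is not claimed.
-/

noncomputable section

open scoped BigOperators InnerProductSpace ENNReal Pointwise
open MeasureTheory Set

namespace Summit.Ventures.Crystal3D.Theorems

open Summit.Ventures.Crystal3D.Cruxes.TextureLiminf.TexShadow (E3)
open Literature.MathematicalPhysics.StatisticalMechanics (fccStacking barlowStacking IsHaggSeq)

/-- **Chimera lower bound for a grain with finitely many separated twin caps about different axes.**
Let `P` (open) lie strictly below the planes `⟪x, m i⟫ = t i` and let the open caps `C i` lie strictly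
above them, pairwise `δ`-separated (`δ > 0`); let the parent frame `A₀` and the cap frame `B i` satisfy
the crux's co-axiality clause `Ax (m i) A₀ (B i)` for every `i` (so `W(B i)` is `W(A₀)` or its twin
across the plane `⊥ m i`).  If `0 < |P ∪ ⋃ C i| < ∞`, `0 < r` with `2(√5+1)·r ≤ δ`, and a set
`U` contains `x + r·w` for all `x ∈ P`, `w ∈ W(A₀)` and all `x ∈ C i`, `w ∈ W(B i)`, then
`|P ∪ ⋃ C i|^{1/3} + r·32^{1/3} ≤ |U|^{1/3}`.  (Piecewise Brunn–Minkowski with proportional quantile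
targets; see the module docstring.) -/
theorem twinCaps_chimera_lower {k : ℕ} (m : Fin k → E3) (t : Fin k → ℝ)
    (A₀ : E3 ≃ₗᵢ[ℝ] E3) (B : Fin k → (E3 ≃ₗᵢ[ℝ] E3))
    (hAx : ∀ i, ∃ (L : E3 ≃ₗᵢ[ℝ] E3) (s₁ s₂ : E3) (σ σ' : ℤ → ℤ), IsHaggSeq σ ∧ IsHaggSeq σ' ∧
      L (EuclideanSpace.single (2 : Fin 3) (1 : ℝ)) = m i ∧
      A₀ '' fccStacking 1 (Real.sqrt (2 / 3)) ⊆
        (fun q => L q + s₁) '' barlowStacking 1 (Real.sqrt (2 / 3)) σ ∧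
      B i '' fccStacking 1 (Real.sqrt (2 / 3)) ⊆
        (fun q => L q + s₂) '' barlowStacking 1 (Real.sqrt (2 / 3)) σ')
    (P : Set E3) (C : Fin k → Set E3) (hPo : IsOpen P) (hCo : ∀ i, IsOpen (C i))
    (hPt : ∀ x ∈ P, ∀ i, ⟪x, m i⟫_ℝ < t i) (hCt : ∀ i, ∀ x ∈ C i, t i < ⟪x, m i⟫_ℝ)
    {δ : ℝ} (hδ : 0 < δ) (hsep : ∀ i j, i ≠ j → ∀ x ∈ C i, ∀ y ∈ C j, δ ≤ dist x y)
    (h0 : volume (P ∪ ⋃ i, C i) ≠ 0) (htop : volume (P ∪ ⋃ i, C i) ≠ ⊤)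
    {r : ℝ} (hr : 0 < r) (hrδ : r * (2 * (Real.sqrt 5 + 1)) ≤ δ)
    {U : Set E3}
    (hsubP : ∀ x ∈ P, ∀ w ∈ {y : E3 | ∀ ν : E3, ⟪y, ν⟫_ℝ ≤ Real.sqrt 2 / 4 *
        ∑ᶠ w ∈ {w | w ∈ fccStacking 1 (Real.sqrt (2 / 3)) ∧ ‖w‖ = 1}, |⟪w, A₀.symm ν⟫_ℝ|},
      x + r • w ∈ U)
    (hsubC : ∀ i, ∀ x ∈ C i, ∀ w ∈ {y : E3 | ∀ ν : E3, ⟪y, ν⟫_ℝ ≤ Real.sqrt 2 / 4 *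
        ∑ᶠ w ∈ {w | w ∈ fccStacking 1 (Real.sqrt (2 / 3)) ∧ ‖w‖ = 1}, |⟪w, (B i).symm ν⟫_ℝ|},
      x + r • w ∈ U) :
    volume (P ∪ ⋃ i, C i) ^ ((3 : ℕ)⁻¹ : ℝ) +
        ENNReal.ofReal r * (ENNReal.ofReal 32) ^ ((3 : ℕ)⁻¹ : ℝ) ≤ volume U ^ ((3 : ℕ)⁻¹ : ℝ) := by
  classical
  -- the bodies
  set body : (E3 ≃ₗᵢ[ℝ] E3) → Set E3 := fun X => {y : E3 | ∀ ν : E3, ⟪y, ν⟫_ℝ ≤ Real.sqrt 2 / 4 *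
    ∑ᶠ w ∈ {w | w ∈ fccStacking 1 (Real.sqrt (2 / 3)) ∧ ‖w‖ = 1}, |⟪w, X.symm ν⟫_ℝ|} with hbody
  have hWc : ∀ X, IsCompact (body X) := fun X => isCompact_cruxWulffBody X
  have hWm : ∀ X, MeasurableSet (body X) := fun X => (hWc X).isClosed.measurableSet
  have hWball : ∀ X, body X ⊆ Metric.closedBall (0 : E3) (Real.sqrt 5) := fun X =>
    cruxWulffBody_subset_closedBall X
  have hWvol : ∀ X, volume (body X) = ENNReal.ofReal 32 := fun X => volume_cruxWulffBody X
  -- unit axes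
  have hm1 : ∀ i, ‖m i‖ = 1 := by
    intro i
    obtain ⟨L, -, -, -, -, -, -, hLm, -, -⟩ := hAx i
    rw [← hLm, LinearIsometryEquiv.norm_map]
    simp
  -- self-clauses of the parent and of the caps about `m i`
  have hselfA : ∀ i, ∃ (L : E3 ≃ₗᵢ[ℝ] E3) (s₁ s₂ : E3) (σ σ' : ℤ → ℤ), IsHaggSeq σ ∧ IsHaggSeq σ' ∧
      L (EuclideanSpace.single (2 : Fin 3) (1 : ℝ)) = m i ∧
      A₀ '' fccStacking 1 (Real.sqrt (2 / 3)) ⊆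
        (fun q => L q + s₁) '' barlowStacking 1 (Real.sqrt (2 / 3)) σ ∧
      A₀ '' fccStacking 1 (Real.sqrt (2 / 3)) ⊆
        (fun q => L q + s₂) '' barlowStacking 1 (Real.sqrt (2 / 3)) σ' := by
    intro i
    obtain ⟨L, s₁, -, σ, -, hσ, -, hLm, h1, -⟩ := hAx i
    exact ⟨L, s₁, s₁, σ, σ, hσ, hσ, hLm, h1, h1⟩
  have hselfB : ∀ i, ∃ (L : E3 ≃ₗᵢ[ℝ] E3) (s₁ s₂ : E3) (σ σ' : ℤ → ℤ), IsHaggSeq σ ∧ IsHaggSeq σ' ∧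
      L (EuclideanSpace.single (2 : Fin 3) (1 : ℝ)) = m i ∧
      B i '' fccStacking 1 (Real.sqrt (2 / 3)) ⊆
        (fun q => L q + s₁) '' barlowStacking 1 (Real.sqrt (2 / 3)) σ ∧
      B i '' fccStacking 1 (Real.sqrt (2 / 3)) ⊆
        (fun q => L q + s₂) '' barlowStacking 1 (Real.sqrt (2 / 3)) σ' := by
    intro i
    obtain ⟨L, -, s₂, -, σ', -, hσ', hLm, -, h2⟩ := hAx i
    exact ⟨L, s₂, s₂, σ', σ', hσ', hσ', hLm, h2, h2⟩
  -- disjointness and measurability of the grains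
  have hPm : MeasurableSet P := hPo.measurableSet
  have hCm : ∀ i, MeasurableSet (C i) := fun i => (hCo i).measurableSet
  have hPC : ∀ i, Disjoint P (C i) := fun i => Set.disjoint_left.2 fun x hxP hxC =>
    lt_irrefl _ ((hPt x hxP i).trans (hCt i x hxC))
  have hCC : ∀ i j, i ≠ j → Disjoint (C i) (C j) := fun i j hij =>
    Set.disjoint_left.2 fun x hxi hxj => by
      have h := hsep i j hij x hxi x hxj
      rw [dist_self] at h
      exact absurd h (not_le.2 hδ)
  have hPUC : Disjoint P (⋃ i, C i) := Set.disjoint_iUnion_right.2 hPC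
  have hUCm : MeasurableSet (⋃ i, C i) := MeasurableSet.iUnion hCm
  -- volumes
  set V : ℝ≥0∞ := volume (P ∪ ⋃ i, C i) with hV
  have hVsum : V = volume P + ∑ i, volume (C i) := by
    rw [hV, measure_union hPUC hUCm, measure_iUnion (fun i j hij => hCC i j hij) hCm, tsum_fintype]
  have hPfin : volume P ≠ ⊤ := (lt_of_le_of_lt (measure_mono subset_union_left) htop.lt_top).ne
  have hCfin : ∀ i, volume (C i) ≠ ⊤ := fun i =>
    (lt_of_le_of_lt (measure_mono ((subset_iUnion C i).trans subset_union_right)) htop.lt_top).ne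
  set Vr : ℝ := V.toReal with hVr
  set vP : ℝ := (volume P).toReal with hvP
  set vC : Fin k → ℝ := fun i => (volume (C i)).toReal with hvC
  have hvP0 : 0 ≤ vP := ENNReal.toReal_nonneg
  have hvC0 : ∀ i, 0 ≤ vC i := fun i => ENNReal.toReal_nonneg
  have hVr_eq : Vr = vP + ∑ i, vC i := by
    rw [hVr, hVsum, ENNReal.toReal_add hPfin (ENNReal.sum_ne_top.2 fun i _ => hCfin i),
      ENNReal.toReal_sum fun i _ => hCfin i]
  have hVr0 : 0 < Vr := ENNReal.toReal_pos h0 htop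
  -- volume fractions
  set σP : ℝ := vP / Vr with hσP
  set σC : Fin k → ℝ := fun i => vC i / Vr with hσC
  have hσC0 : ∀ i, 0 ≤ σC i := fun i => div_nonneg (hvC0 i) hVr0.le
  have hσC1 : ∀ i, σC i ≤ 1 := by
    intro i
    rw [hσC]
    refine (div_le_one hVr0).2 ?_
    rw [hVr_eq]
    have := Finset.single_le_sum (fun j _ => hvC0 j) (Finset.mem_univ i)
    linarith
  have hσP0 : 0 ≤ σP := div_nonneg hvP0 hVr0.le
  have hσsum : σP + ∑ i, σC i = 1 := by
    simp only [hσP, hσC]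
    rw [← Finset.sum_div, ← add_div, ← hVr_eq, div_self hVr0.ne']
  -- quantile heights `s i`: `|W(A₀) ∩ {s i < ⟪y, m i⟫}| = 32·σC i`
  have hq : ∀ i, ∃ si : ℝ,
      ENNReal.ofReal (32 * σC i) ≤ volume (body A₀ ∩ {y : E3 | si < ⟪y, m i⟫_ℝ}) ∧
      volume (body A₀ ∩ {y : E3 | si < ⟪y, m i⟫_ℝ}) ≤ ENNReal.ofReal (32 * σC i) := by
    intro i
    obtain ⟨q, -, hq⟩ := exists_quantile_of_isCompact (m i) (hm1 i) (body A₀) (hWc A₀)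
      (Real.sqrt_nonneg 5) (hWball A₀) (by norm_num : (0:ℝ) ≤ 32) (hWvol A₀)
    refine ⟨q (1 - σC i), ?_, ?_⟩
    · have h := hq (1 - σC i) 1 (by linarith [hσC1 i]) (by linarith [hσC0 i]) le_rfl
      rw [show (1 - (1 - σC i)) * 32 = 32 * σC i by ring] at h
      exact h.trans (measure_mono fun y hy => ⟨hy.1, hy.2.1⟩)
    · have h := hq 0 (1 - σC i) le_rfl (by linarith [hσC1 i]) (by linarith [hσC0 i])
      rw [show (1 - σC i - 0) * 32 = 32 * (1 - σC i) by ring] at h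
      have hlow : ENNReal.ofReal (32 * (1 - σC i)) ≤ volume (body A₀ ∩ {y : E3 | ⟪y, m i⟫_ℝ < q (1 - σC i)}) :=
        h.trans (measure_mono fun y hy => ⟨hy.1, hy.2.2⟩)
      have hgt_m : MeasurableSet {y : E3 | q (1 - σC i) < ⟪y, m i⟫_ℝ} :=
        (isOpen_lt continuous_const (continuous_id.inner continuous_const)).measurableSet
      have hdisj : Disjoint (body A₀ ∩ {y : E3 | ⟪y, m i⟫_ℝ < q (1 - σC i)})
          (body A₀ ∩ {y : E3 | q (1 - σC i) < ⟪y, m i⟫_ℝ}) := by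
        rw [Set.disjoint_left]
        rintro y ⟨-, hy1⟩ ⟨-, hy2⟩
        rw [mem_setOf_eq] at hy1 hy2
        exact lt_irrefl _ (lt_trans hy1 hy2)
      have hle : volume (body A₀ ∩ {y : E3 | ⟪y, m i⟫_ℝ < q (1 - σC i)}) +
          volume (body A₀ ∩ {y : E3 | q (1 - σC i) < ⟪y, m i⟫_ℝ}) ≤ ENNReal.ofReal 32 := by
        rw [← measure_union hdisj ((hWm A₀).inter hgt_m), ← hWvol A₀]
        exact measure_mono (union_subset inter_subset_left inter_subset_left)
      have hfin1 : volume (body A₀ ∩ {y : E3 | ⟪y, m i⟫_ℝ < q (1 - σC i)}) ≠ ⊤ :=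
        (lt_of_le_of_lt (measure_mono inter_subset_left) (hWc A₀).measure_lt_top).ne
      have hfin2 : volume (body A₀ ∩ {y : E3 | q (1 - σC i) < ⟪y, m i⟫_ℝ}) ≠ ⊤ :=
        (lt_of_le_of_lt (measure_mono inter_subset_left) (hWc A₀).measure_lt_top).ne
      rw [← ENNReal.ofReal_toReal hfin2]
      apply ENNReal.ofReal_le_ofReal
      have h1 := ENNReal.toReal_mono ENNReal.ofReal_ne_top hle
      rw [ENNReal.toReal_add hfin1 hfin2, ENNReal.toReal_ofReal (by norm_num : (0:ℝ) ≤ 32)] at h1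
      have h2 := ENNReal.toReal_mono hfin1 hlow
      rw [ENNReal.toReal_ofReal (by nlinarith [hσC1 i])] at h2
      linarith
  choose s hs_lo hs_hi using hq
  -- the targets: `P' = W(A₀) ∩ {∀ i, ⟪y, m i⟫ ≤ s i}`, `K i = W(B i) ∩ {s i < ⟪y, m i⟫}`
  set P' : Set E3 := body A₀ ∩ {y : E3 | ∀ i, ⟪y, m i⟫_ℝ ≤ s i} with hP'
  set K : Fin k → Set E3 := fun i => body (B i) ∩ {y : E3 | s i < ⟪y, m i⟫_ℝ} with hK
  have hgt_m : ∀ i (c : ℝ), MeasurableSet {y : E3 | c < ⟪y, m i⟫_ℝ} := fun i c =>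
    (isOpen_lt continuous_const (continuous_id.inner continuous_const)).measurableSet
  have hP'm : MeasurableSet P' := by
    refine (hWm A₀).inter ?_
    have : {y : E3 | ∀ i, ⟪y, m i⟫_ℝ ≤ s i} = ⋂ i, {y : E3 | ⟪y, m i⟫_ℝ ≤ s i} := by
      ext y; simp only [mem_setOf_eq, mem_iInter]
    rw [this]
    exact MeasurableSet.iInter fun i =>
      (isClosed_le (continuous_id.inner continuous_const) continuous_const).measurableSet
  have hKm : ∀ i, MeasurableSet (K i) := fun i => (hWm (B i)).inter (hgt_m i (s i))
  have hKvol : ∀ i, ENNReal.ofReal (32 * σC i) ≤ volume (K i) := by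
    intro i
    have h := volume_cruxWulffBody_inter_eq_of_coaxial (hselfA i) (hselfB i) (s i)
    show ENNReal.ofReal (32 * σC i) ≤ volume (body (B i) ∩ {y : E3 | s i < ⟪y, m i⟫_ℝ})
    simp only [hbody]
    rw [h]
    exact hs_lo i
  have hP'vol : ENNReal.ofReal (32 * σP) ≤ volume P' := by
    have hcover : body A₀ ⊆ P' ∪ ⋃ i, (body A₀ ∩ {y : E3 | s i < ⟪y, m i⟫_ℝ}) := by
      intro y hy
      by_cases h : ∀ i, ⟪y, m i⟫_ℝ ≤ s i
      · exact Or.inl ⟨hy, h⟩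
      · simp only [not_forall, not_le] at h
        obtain ⟨i, hi⟩ := h
        exact Or.inr (mem_iUnion.2 ⟨i, hy, hi⟩)
    have h1 : ENNReal.ofReal 32 ≤ volume P' + ∑ i, ENNReal.ofReal (32 * σC i) := by
      calc ENNReal.ofReal 32 = volume (body A₀) := (hWvol A₀).symm
        _ ≤ volume (P' ∪ ⋃ i, (body A₀ ∩ {y : E3 | s i < ⟪y, m i⟫_ℝ})) := measure_mono hcover
        _ ≤ volume P' + volume (⋃ i, (body A₀ ∩ {y : E3 | s i < ⟪y, m i⟫_ℝ})) := measure_union_le _ _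
        _ ≤ volume P' + ∑ i, volume (body A₀ ∩ {y : E3 | s i < ⟪y, m i⟫_ℝ}) := by
            gcongr; exact measure_iUnion_fintype_le _ _
        _ ≤ volume P' + ∑ i, ENNReal.ofReal (32 * σC i) := by
            gcongr with i; exact hs_hi i
    have hP'fin : volume P' ≠ ⊤ :=
      (lt_of_le_of_lt (measure_mono inter_subset_left) (hWc A₀).measure_lt_top).ne
    rw [← ENNReal.ofReal_toReal hP'fin]
    apply ENNReal.ofReal_le_ofReal
    have h2 := ENNReal.toReal_mono (ENNReal.add_ne_top.2 ⟨hP'fin, ENNReal.sum_ne_top.2 fun i _ =>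
      ENNReal.ofReal_ne_top⟩) h1
    rw [ENNReal.toReal_ofReal (by norm_num : (0:ℝ) ≤ 32), ENNReal.toReal_add hP'fin
      (ENNReal.sum_ne_top.2 fun i _ => ENNReal.ofReal_ne_top), ENNReal.toReal_sum
      (fun i _ => ENNReal.ofReal_ne_top)] at h2
    simp only [ENNReal.toReal_ofReal (mul_nonneg (by norm_num : (0:ℝ) ≤ 32) (hσC0 _))] at h2
    have h3 : 32 * σP = 32 - ∑ i, 32 * σC i := by
      rw [← Finset.mul_sum]; linarith [hσsum]
    linarith
  -- the regions
  set ρ : ℝ := r * (Real.sqrt 5 + 1) with hρ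
  have hρ0 : 0 < ρ := by positivity
  set R₀ : Set E3 := {y : E3 | ∀ i, ⟪y, m i⟫_ℝ < t i + r * s i} with hR₀
  set R : Fin k → Set E3 := fun i => {y : E3 | t i + r * s i < ⟪y, m i⟫_ℝ} ∩ Metric.thickening ρ (C i)
    with hR
  have hR₀m : MeasurableSet R₀ := by
    have : R₀ = ⋂ i, {y : E3 | ⟪y, m i⟫_ℝ < t i + r * s i} := by
      ext y; simp only [hR₀, mem_setOf_eq, mem_iInter]
    rw [this]
    exact MeasurableSet.iInter fun i =>
      (isOpen_lt (continuous_id.inner continuous_const) continuous_const).measurableSet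
  have hRm : ∀ i, MeasurableSet (R i) := fun i =>
    (hgt_m i _).inter Metric.isOpen_thickening.measurableSet
  have hR₀R : ∀ i, Disjoint (U ∩ R₀) (U ∩ R i) := fun i => Set.disjoint_left.2 fun y hy hy' => by
    have hy1 : t i + r * s i < ⟪y, m i⟫_ℝ := hy'.2.1
    exact lt_irrefl _ ((hy.2 i).trans hy1)
  have hRR : ∀ i j, i ≠ j → Disjoint (U ∩ R i) (U ∩ R j) := by
    intro i j hij
    rw [Set.disjoint_left]
    rintro y ⟨-, -, hyi⟩ ⟨-, -, hyj⟩
    obtain ⟨x, hx, hdx⟩ := Metric.mem_thickening_iff.1 hyi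
    obtain ⟨x', hx', hdx'⟩ := Metric.mem_thickening_iff.1 hyj
    have h1 : δ ≤ dist x x' := hsep i j hij x hx x' hx'
    have h2 : dist x x' < 2 * ρ :=
      calc dist x x' ≤ dist x y + dist y x' := dist_triangle _ _ _
        _ = dist y x + dist y x' := by rw [dist_comm x y]
        _ < ρ + ρ := add_lt_add hdx hdx'
        _ = 2 * ρ := by ring
    have h3 : 2 * ρ ≤ δ := by rw [hρ]; linarith
    linarith
  -- the swollen pieces lie in `U` and in their regions
  have hincP : P + r • P' ⊆ U ∩ R₀ := by
    rintro z ⟨x, hx, y, hy, rfl⟩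
    obtain ⟨p, hp, rfl⟩ := Set.mem_smul_set.1 hy
    refine ⟨hsubP x hx p hp.1, fun i => ?_⟩
    have h1 : ⟪x + r • p, m i⟫_ℝ = ⟪x, m i⟫_ℝ + r * ⟪p, m i⟫_ℝ := by
      rw [inner_add_left, inner_smul_left]; simp
    rw [h1]
    have h2 : r * ⟪p, m i⟫_ℝ ≤ r * s i := mul_le_mul_of_nonneg_left (hp.2 i) hr.le
    linarith [hPt x hx i]
  have hincC : ∀ i, C i + r • K i ⊆ U ∩ R i := by
    intro i
    rintro z ⟨x, hx, y, hy, rfl⟩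
    obtain ⟨p, hp, rfl⟩ := Set.mem_smul_set.1 hy
    refine ⟨hsubC i x hx p hp.1, ?_, ?_⟩
    · have h1 : ⟪x + r • p, m i⟫_ℝ = ⟪x, m i⟫_ℝ + r * ⟪p, m i⟫_ℝ := by
        rw [inner_add_left, inner_smul_left]; simp
      rw [mem_setOf_eq, h1]
      have hp2 : s i < ⟪p, m i⟫_ℝ := hp.2
      have h2 : r * s i < r * ⟪p, m i⟫_ℝ := mul_lt_mul_of_pos_left hp2 hr
      linarith [hCt i x hx]
    · rw [Metric.mem_thickening_iff]
      refine ⟨x, hx, ?_⟩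
      have hp5 : ‖p‖ ≤ Real.sqrt 5 := mem_closedBall_zero_iff.1 (hWball (B i) hp.1)
      rw [dist_eq_norm, add_sub_cancel_left, norm_smul, Real.norm_of_nonneg hr.le, hρ]
      calc r * ‖p‖ ≤ r * Real.sqrt 5 := by gcongr
        _ < r * (Real.sqrt 5 + 1) := by nlinarith
  -- assemble: the piecewise Brunn–Minkowski lemma on the index type `Option (Fin k)`
  set G : Option (Fin k) → Set E3 := fun o => o.elim P C with hG
  set T : Option (Fin k) → Set E3 := fun o => o.elim P' K with hT
  have hUG : (⋃ o, G o) = P ∪ ⋃ i, C i := by rw [Set.iUnion_option]; rfl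
  have hGo : ∀ o, IsOpen (G o) := fun o => by
    cases o with
    | none => exact hPo
    | some i => exact hCo i
  have hTm : ∀ o, MeasurableSet (T o) := fun o => by
    cases o with
    | none => exact hP'm
    | some i => exact hKm i
  have hdisjG : Pairwise fun o o' => Disjoint (G o) (G o') := by
    intro o o' hoo'
    cases o with
    | none =>
      cases o' with
      | none => exact absurd rfl hoo'
      | some j => exact hPC j
    | some i =>
      cases o' with
      | none => exact (hPC i).symm
      | some j => exact hCC i j fun h => hoo' (by rw [h])
  have hreg : ∀ o : Option (Fin k), G o + r • T o ⊆ U ∩ o.elim R₀ R := fun o => by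
    cases o with
    | none => exact hincP
    | some i => exact hincC i
  have hdisjR : Pairwise fun o o' : Option (Fin k) => Disjoint (U ∩ o.elim R₀ R) (U ∩ o'.elim R₀ R) := by
    intro o o' hoo'
    cases o with
    | none =>
      cases o' with
      | none => exact absurd rfl hoo'
      | some j => exact hR₀R j
    | some i =>
      cases o' with
      | none => exact (hR₀R i).symm
      | some j => exact hRR i j fun h => hoo' (by rw [h])
  have hdisj : Pairwise fun o o' => Disjoint (G o + r • T o) (G o' + r • T o') :=
    fun o o' hoo' => (hdisjR hoo').mono (hreg o) (hreg o')
  have h0' : volume (⋃ o, G o) ≠ 0 := by rwa [hUG]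
  have htop' : volume (⋃ o, G o) ≠ ⊤ := by rwa [hUG]
  have hTvol : ∀ o, ENNReal.ofReal (32 * ((volume (G o)).toReal / (volume (⋃ o, G o)).toReal)) ≤
      volume (T o) := by
    intro o
    rw [hUG]
    cases o with
    | none => exact hP'vol
    | some i => exact hKvol i
  have h := piecewise_chimera_lower G T (by norm_num : (0:ℝ) < 32) hGo hTm hdisjG h0' htop' hr hTvol
    hdisj (fun o => (hreg o).trans inter_subset_left)
  rwa [hUG] at h

end Summit.Ventures.Crystal3D.Theorems

end
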